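import Summits.BirchSwinnertonDyer.BirchSwinnertonDyer.Theorems.KolyvaginDepthDoorDepthTableRankTwo997c1Neg23TwistBSDQuotient
import Summits.BirchSwinnertonDyer.BirchSwinnertonDyer.Theorems.KolyvaginDepthDoorDepthTableSteinWuthrichEvenRankBSDQuotientExact
import Literature.NumberTheory.EllipticCurves.IrreducibleModPQuadraticTwistProofs
import HarnessLib

/-!
# Route `KolyvaginDepthDoor`, crux `KolyvaginDepthSupplyKN` (stmt-BirchSwinnertonDyer-22820) —
# DEPTH TABLE v15, EXACT ROW `997c1` at `(p, d_K) = (5, -23)` MODULO THE RANK OF `E`: ONE KOLYVAGIN BIT ⟺ `rank E = 2` ∧ THE BSD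
# QUOTIENT OF THE HEEGNER TWIST IS A `5`-ADIC UNIT

Helper file of the lead prover of line `levelone` (kdd-p1 g19; `--supports stmt-BirchSwinnertonDyer-22820
--as helper`); it closes nothing and BSD is NOT proved by it.

`997c1` has no 2-descent certificate in the tree, so its v13 row (`C997c1.exactRowZhang_5_neg23_oneTwistModRank`, g17) reads «bit ⟺ `rank E = 2` ∧ `rank E^{(d_K)} = 1` ∧
`Ш(E^{(d_K)})[5] = 0`» at the kernel-point field `d_K = -23`. With the g19 minimal model `T₀ = [0, -1, 1, -12872, -557532]` of the twist (`KolyvaginDepthDoorDepthTableRankTwo997c1Neg23TwistBSDQuotient`),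
GZK on `T₀` (`ord_{s=1} L(T₀,s) = 1` ⟹ rank `1`, transported along `minTwist23_smul_eq` by `VariableChange.finrank_point_variableChange`) and
AEC X.4.2 (`natCard_selmerGroup_le_iff_rank_eq_one_sha₁₅`; irreducibility transported by `Mazur1978.hasIrreducibleModPGaloisRep_smul_iff`), the
twist conjuncts become «`#Sel_5(T) ≤ 5`», and the generic `natCard_selmerGroup_le_iff_bsdQuotient_unit_bcs` (BCS 2025 Cor. 1.3.1 + GZK)
turns that into the unit-ness of the BSD quotient:

* `exactRow_5_neg23_bsdQuotientUnit_modRank` — for every `K` with `d_K = -23`, GIVEN `ord_{s=1} L(T₀,s) = 1`: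
  bit ⟺ «`rank_ℤ E(ℚ) = 2` ∧ `∃ q ∈ ℚ, L'(T₀,1)/(Ω_{T₀}·Reg_{T₀}) = q ∧ ord_5 q = 0`».

CONDITIONAL on the named print facts; per curve; nothing class-wide (the open stub (S♭) is untouched); BSD is NOT proved by it.

References: [BurungaleCastellaSkinner2025] Cor. 1.3.1; [Darmon2004] Thm. 3.22; [SteinWuthrich2013] Thm. 1.1; [WZhang2014] L8.4 (1), Thm. 9.1;
[Mazur1978] §5; [SilvermanAEC2009] III.3.1 (b), X.4.2.
-/

set_option linter.dupNamespace false

noncomputable section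

open scoped Classical NumberField

namespace Summit.BirchSwinnertonDyer.BirchSwinnertonDyer.Theorems.KolyvaginDepthDoor

open Literature.NumberTheory.EllipticCurves Literature.NumberTheory.EllipticCurves.ModularForms
  WeierstrassCurve NumberField IsDedekindDomain
open Summit.BirchSwinnertonDyer.BirchSwinnertonDyer.Theorems
open Summit.BirchSwinnertonDyer.BirchSwinnertonDyer.Rank2Observatory
open Summit.BirchSwinnertonDyer.BirchSwinnertonDyer.Rank1Residual
open Summit.BirchSwinnertonDyer.Rank1Residual.Additive

namespace C997c1

/-- **EXACT DEPTH-TABLE ROW `997c1` AT `(p, d_K) = (5, -23)`, BSD-QUOTIENT CURRENCY, MODULO `rank E = 2`.** For `E = 997c1`, ANY imaginary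
quadratic `K` with `d_K = -23`, and the minimal model `T₀ = [0, -1, 1, -12872, -557532]` of `E^{(-23)}`, GRANTED `ord_{s=1} L(T₀, s) = 1`: «some frame, some Kolyvagin
prime `ℓ`, some datum with `c_1(ℓ) ≠ 0`» ⟺ «`rank_ℤ E(ℚ) = 2` ∧ `∃ q ∈ ℚ`, `L'(T₀,1)/(Ω_{T₀}·Reg_{T₀}) = q`, `ord_5 q = 0`». From the v13 row
`exactRowZhang_5_neg23_oneTwistModRank`; GZK rank one of `T₀` and irreducibility transported to `E.quadraticTwist (-23)` along `minTwist23_smul_eq`; AEC X.4.2;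
`natCard_selmerGroup_le_iff_bsdQuotient_unit_bcs`. CONDITIONAL on the named print facts and `r_an(T₀) = 1`; per curve; BSD is not proved by it.
[cite: BurungaleCastellaSkinner2025, Cor. 1.3.1 (p. 4)] [cite: Darmon2004, Thm. 3.22] [cite: SteinWuthrich2013, Thm. 1.1 (p. 1758)] [cite: WZhang2014, Lemma 8.4 (1) (p. 236), Thm. 9.1 (p. 240)] [cite: SilvermanAEC2009, Thm. X.4.2] -/
theorem exactRow_5_neg23_bsdQuotientUnit_modRank
    (hSW : SteinWuthrich2013_sha_inf_torsionBy_eq_bot_of_two_le_rank)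
    (h372 : GrossLMS1991.prop37_2_frobeniusCongruence)
    (h84 : Literature.NumberTheory.EllipticCurves.WZhang2014_lemma84_exists_minimal_kolyvaginClass_one_selmerCard)
    (hBCS : BurungaleCastellaSkinner2025.cor131_padicValRat_bsd_rank_le_one)
    (hGZK : rank_eq_analyticRank_of_analyticRank_le_one)
    (K : Type) [Field K] [NumberField K] (hK : IsImaginaryQuadratic K) (hD : NumberField.discr K = -23)
    (hr : haveI := minTwist23_isElliptic;
      ((⟨0, -1, 1, -12872, -557532⟩ : WeierstrassCurve ℤ).map (Int.castRingHom ℚ)).analyticRank = 1) :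
    haveI := isElliptic_c997c1;
    haveI := isGloballyMinimal_c997c1;
    haveI : NeZero (((⟨0, -1, 1, -24, 54⟩ : WeierstrassCurve ℤ).map (Int.castRingHom ℚ)).conductorNorm ℤ) := neZero_conductorNorm_of_isElliptic _;
    haveI := Fact.mk (by norm_num : Nat.Prime 5);
    (∃ (Dt : ModularParametrizationData ((⟨0, -1, 1, -24, 54⟩ : WeierstrassCurve ℤ).map (Int.castRingHom ℚ)) (((⟨0, -1, 1, -24, 54⟩ : WeierstrassCurve ℤ).map (Int.castRingHom ℚ)).conductorNorm ℤ)) (β : ℤ)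
      (ι : K →+* ℂ) (ℓ : ℕ) (d : KolyvaginHeegnerData Dt β ι ℓ),
      ℓ.Prime ∧ Zhang2014.IsKolyvaginPrime (((⟨0, -1, 1, -24, 54⟩ : WeierstrassCurve ℤ).map (Int.castRingHom ℚ)).conductorNorm ℤ) ((⟨0, -1, 1, -24, 54⟩ : WeierstrassCurve ℤ).map (Int.castRingHom ℚ)) K 5 ℓ ∧
        d.kolyvaginClass (p := 5) (by norm_num) 1 ≠ 0) ↔
    (((⟨0, -1, 1, -24, 54⟩ : WeierstrassCurve ℤ).map (Int.castRingHom ℚ)).mordellWeilRank = 2 ∧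
      (haveI := minTwist23_isElliptic; haveI := minTwist23_isGloballyMinimal;
        ∃ q : ℚ, ((⟨0, -1, 1, -12872, -557532⟩ : WeierstrassCurve ℤ).map (Int.castRingHom ℚ)).leadingLCoeff /
            (((((⟨0, -1, 1, -12872, -557532⟩ : WeierstrassCurve ℤ).map (Int.castRingHom ℚ)).realPeriodRat *
                ((⟨0, -1, 1, -12872, -557532⟩ : WeierstrassCurve ℤ).map (Int.castRingHom ℚ)).regulator : ℝ)) : ℂ) = (q : ℂ) ∧
          padicValRat 5 q = 0)) := by
  haveI := isElliptic_c997c1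
  haveI := isGloballyMinimal_c997c1
  haveI : NeZero (((⟨0, -1, 1, -24, 54⟩ : WeierstrassCurve ℤ).map (Int.castRingHom ℚ)).conductorNorm ℤ) := neZero_conductorNorm_of_isElliptic _
  haveI := Fact.mk (by norm_num : Nat.Prime 5)
  refine (exactRowZhang_5_neg23_oneTwistModRank hSW h372 h84 K hK hD).trans (and_congr_right fun _ ↦ ?_)
  have hcast : (NumberField.discr K : ℚ) = ((-23) : ℚ) := by rw [hD]; norm_num
  rw [hcast]
  haveI iT := minTwist23_isElliptic
  haveI := minTwist23_isGloballyMinimal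
  -- GZK on `T₀`: rank one, transported to `E.quadraticTwist d` along the `ℚ`-isomorphism
  have hrk0 : ((⟨0, -1, 1, -12872, -557532⟩ : WeierstrassCurve ℤ).map (Int.castRingHom ℚ)).mordellWeilRank = 1 := (hGZK _ (by rw [hr])).1.trans hr
  have hMW : ((⟨1, (8 : ℚ), (0 : ℚ), -((1 : ℚ) / 2)⟩ : WeierstrassCurve.VariableChange ℚ) •
        ((⟨0, -1, 1, -12872, -557532⟩ : WeierstrassCurve ℤ).map (Int.castRingHom ℚ))).mordellWeilRank = ((⟨0, -1, 1, -12872, -557532⟩ : WeierstrassCurve ℤ).map (Int.castRingHom ℚ)).mordellWeilRank :=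
    @WeierstrassCurve.VariableChange.finrank_point_variableChange ℚ _ _ _ (Classical.decEq ℚ)
  have hrk : (((⟨0, -1, 1, -24, 54⟩ : WeierstrassCurve ℤ).map (Int.castRingHom ℚ)).quadraticTwist ((-23) : ℚ)).mordellWeilRank = 1 := by
    rw [← minTwist23_smul_eq, hMW, hrk0]
  -- irreducibility of the twist's `5`-torsion, transported likewise
  have hirr0 : ((⟨0, -1, 1, -12872, -557532⟩ : WeierstrassCurve ℤ).map (Int.castRingHom ℚ)).HasIrreducibleModPGaloisRep 5 :=
    hasIrreducibleModPGaloisRep_of_hasSurjectiveModNGaloisRep _ 5 minTwist23_hasSurjectiveModNGaloisRep_5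
  have hirr : (((⟨0, -1, 1, -24, 54⟩ : WeierstrassCurve ℤ).map (Int.castRingHom ℚ)).quadraticTwist ((-23) : ℚ)).HasIrreducibleModPGaloisRep 5 := by
    rw [← minTwist23_smul_eq]; exact (Mazur1978.hasIrreducibleModPGaloisRep_smul_iff _ _ 5).mpr hirr0
  haveI : (((⟨0, -1, 1, -24, 54⟩ : WeierstrassCurve ℤ).map (Int.castRingHom ℚ)).quadraticTwist ((-23) : ℚ)).IsElliptic := by rw [← minTwist23_smul_eq]; infer_instance
  rw [← natCard_selmerGroup_le_iff_rank_eq_one_sha₁₅ _ 5 hirr (by rw [hrk]),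
    ← natCard_selmerGroup_eq_of_variableChange (((5 : ℕ) : ℤ)) minTwist23_smul_eq]
  exact natCard_selmerGroup_le_iff_bsdQuotient_unit_bcs hBCS hGZK _ 5 (by norm_num) minTwist23_not_hasCM
    minTwist23_goodOrdinary_5.1 minTwist23_goodOrdinary_5.2 minTwist23_hasSurjectiveModNGaloisRep_5 minTwist23_kodairaNeron_5 hr

end C997c1

end Summit.BirchSwinnertonDyer.BirchSwinnertonDyer.Theorems.KolyvaginDepthDoor

end
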